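import Mathlib
import Literature.MathematicalPhysics.QuantumFieldTheory.Balaban1983to89.Beta.OneLoop

/-!
# `Balaban1983to89.Beta.GaussianIntegral` — BETA sub-cell, kernel node BETA-0-GAUSSINT-KERNEL: the MEASURE-THEORETIC
Gaussian integral behind `Beta.ConstrainedGaussian.logZ` (cell GAPS obligation C-beta-6, integral half), kernel-checked

HONEST FRAMING (BETA-SPEC.md, verbatim): discharging `BetaPertH` makes Bałaban's UV stability UNCONDITIONAL — a real
constructive-QFT result; it is NOT the continuum limit and NOT the Clay problem.  THIS MODULE DISCHARGES NOTHING of the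
series: it proves, as theorems about real numbers and Lebesgue integrals on `Fin n → ℝ`, that the CLOSED FORM which unit
pv25's landed module `…Beta.OneLoop` (p177267) takes as the DEFINITION of `log Z^{(k)}(U)` IS the logarithm of the
constrained Gaussian integral it names.  Value = kernel theorem about Gaussian integrals, NOT summit progress.

CITATION HEADER (lean-in-tree rule 2026-08-18).  The printed objects, verbatim:
* T. Bałaban, *Renormalization group approach to lattice gauge field theories. I*, Commun. Math. Phys. **109**, 249–301
  (1987) [Balaban1987RG1] (cell paper B12; PDF page = journal page − 248), p. 260 [PDF 12]: *"We have written explicitly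
  terms of the order 0 in the coupling constants. Let us recall that the factor Z^{(j)}(U_k) is given by the Gaussian
  integral normalizing the Gaussian measure for a fluctuation field in j-th step integration
  Z^{(j)}(U_k) = ∫ dB δ(Q̃B) exp\[−½⟨B, Δ^{(j)}(U_k)B⟩\]. (1.4)"*.
* T. Bałaban, *Propagators and renormalization transformations for lattice gauge theories. I*, Commun. Math. Phys.
  **95**, 17–40 (1984) [Balaban1984PropagatorsI] (cell paper B5; PDF page = journal page − 16), p. 19 [PDF 3] — the
  δ-CONVENTION: *"(QA)_c = Σ_{x∈B(c₋)} L^{−(d+1)}A(\[x, x(c)\]), δ(B − QA) = ∏_{c⊂T_L^{(1)}} δ(B_c − (QA)_c), (1.11) then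
  the renormalization transformation T is defined by (Te^{−S})(B) = ∫dA δ(B − QA)δ_{Ax}(A)e^{−S(A)}. (1.12)"* and *"The
  integral in (1.12) is obviously a Gaussian integral. We will prove later that the quadratic form ⟨∂A, ∂A⟩ is positive
  on the subspace of A satisfying QA = 0, A(Γ_{y,x}) = 0, x∈B(y), y∈T_L^{(1)}. A result of the integration is obviously a
  Gaussian density (Te^{−S})(B) = Z^{(0)} exp(−½⟨B, Δ₁B⟩) = Z^{(0)} exp(−S₁(B)). (1.14)"*.
* T. Bałaban, *Propagators for lattice gauge theories in a background field*, Commun. Math. Phys. **99**, 389–434 (1985)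
  [Balaban1985BackgroundPropagators] (cell paper B9; PDF page = journal page − 388), p. 428 [PDF 40]: *"Variables B
  depend linearly on B̃ and we have B = CB̃, where C is a linear operator."*, (3.157)
  *"e^{(1/2)⟨g,C^{(k)}(Λ)g⟩} = (Z′^{(k)}(Λ))^{−1}∫dB̃ exp\[−½⟨B̃, C\*Δ_kCB̃⟩ + ⟨B̃, C\*g⟩\]"*, and *"a positive definite
  operator C\*Δ_kC"*.

THE MODEL AUDITED (tree, unit pv25, `…Beta.OneLoop`): `Z : ConstrainedGaussian n m` = (`Z.Q : m × n` = Q̃, `Z.Δ : n × n`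
= Δ^{(j)}(U_k)); `Z.Regular` = (`Q` onto, `Δ` symmetric, `0 < vᵀΔv` on `ker Q ∖ {0}` — the printed positivity sentence of
B5 p. 19 above); `Z.kkt = [[Δ, Qᵀ],[Q, 0]]`; `Z.logZ := ((n − m)/2)·log 2π − ½·log |det Z.kkt|` (a DEFINITION, junk outside
`Regular`); `Z.reduced C = CᵀΔC`, `Z.logZred C := (r/2)·log 2π − ½·log det(CᵀΔC)`.

WHAT IS PROVED (0 sorry; Mathlib only + the definitions of `…Beta.OneLoop`; no hypothesis beyond those displayed):
(1) `GaussianIntegral.integral_exp_neg_half_quadForm`: for `A` positive definite on a finite index type `ι`,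
    `∫_{ι → ℝ} exp(−½ vᵀAv) dv = √(2π)^{|ι|} / √(det A)` (Lebesgue = product measure `volume`), with integrability and the
    log form `(|ι|/2)·log 2π − ½·log det A`; tools: `A = BᵀB` (Mathlib's C⋆-order on real matrices), the linear change of
    variables `∫ f(Bv) dv = |det B|⁻¹ ∫ f` (`map_linearMap_addHaar_eq_smul_addHaar`) and `∫ e^{−x²/2} = √(2π)`.
(2) THE δ-FUNCTION, realised in the printed convention.  B5 (1.11) defines `δ(B − QA)` as the PRODUCT over the `m` target
    coordinates `c` of one-dimensional Dirac δ's, i.e. the unit-mass point measure of `ℝ^m` (Lebesgue-normalised) pulled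
    back along the surjection `v ↦ Qv`.  We realise it by the heat-kernel approximate identity
    `δ_ε(y) := (2πε)^{−m/2} e^{−|y|²/(2ε)} = ∏_c (2πε)^{−1/2} e^{−y_c²/(2ε)}` (unit mass: `heatKernel_mass_one`), and define
    the REGULARISED constrained integral `Z.regZ ε := ∫ δ_ε(Qv) e^{−½ vᵀΔv} dv` (`ConstrainedGaussian.regZ`).  Then:
    (a) `regZ_eq`, `det_kktReg`, `log_regZ_eq`: for `ε > 0` with `Δ_ε := Δ + ε⁻¹QᵀQ` positive definite,
        `log Z_ε = ((n − m)/2)·log 2π − ½·log |det K_ε|`, `K_ε := [[Δ, Qᵀ],[Q, −ε·1]]`, EXACTLY pv25's closed form with the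
        bordered matrix regularised in its zero corner (`det K_ε = (−ε)^m det Δ_ε`, Schur complement);
    (b) `exists_posDef_add_smul` (FINSLER's lemma, compactness of the unit sphere): `Δ` symmetric and positive on
        `ker Q ∖ {0}` ⇒ `Δ + t·QᵀQ` positive definite for all large `t`; hence (`eventually_posDef_precReg`) under `Regular`
        the closed form (a) holds for all small `ε > 0`;
    (c) `tendsto_log_regZ`, `tendsto_regZ`, `exp_logZ`: under `Regular`, `log Z_ε → Z.logZ` and
        `Z_ε → exp(Z.logZ) = (2π)^{(n−m)/2}|det Z.kkt|^{−1/2}` as `ε ↓ 0` — the limit exists and EQUALS pv25's definition: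
        `Z.logZ` is the logarithm of the constrained Gaussian integral (1.4) with δ := B5's (1.11), no Jacobian lost or added.
(3) B9's reduced normalisation: `log_integral_reduced`: `log ∫_{ℝ^r} exp(−½ wᵀ(CᵀΔC)w) dw = Z.logZred C` whenever `CᵀΔC` is
    positive definite, which (`posDef_reduced`) holds under `Regular` for every injective `C` with `QC = 0` (B9 p. 428 "a
    positive definite operator C\*Δ_kC"); and the definitional dictionary `logZ_sub_logZred`:
    `Z.logZ − Z.logZred C = ½(log det(CᵀΔC) − log |det Z.kkt|)` for `r + m = n` — the "Jacobian of `w ↦ Cw` relative to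
    δ(Q·)" of the `logZred` docstring, in closed form.

WHAT IS NOT HERE (other seats, one owner per statement — BETA-0 owner NOTE 2026-08-18T17:56:25Z and the split NOTEs
17:57:52Z / 18:01:47Z in the cell journal): the DETERMINANT ALGEBRA evaluating `|det Z.kkt|` against `det(CᵀΔC)` —
adapted coordinates `|det K| = det(CᵀΔC)·(det Q_κ)²` and Bałaban's `C` of B9 p. 428 (unit pv03-g3, tree
`…Beta.ConstraintElimination`, e.g. `ConstrainedGaussian.logZ_eq_logZred_sub_log`), the Gram form
`det(CᵀC)·det K = (−1)^m det(QQᵀ)·det(CᵀΔC)`, the sign `0 < (−1)^m det K` and the PUBLIC statement `Regular Z → det Z.kkt ≠ 0`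
(unit pv23, module `…Beta.KKTBridge`, in preparation; the instance this file needs is proved PRIVATELY below and is to be
swapped for pv23's theorem by name once that lands — no public restatement here); the Hessian calculus of `log det` (unit
pv09-g2, `…Beta.LogDetVariation`); the composition law (unit pv28, `…Beta.Composition`).  Nothing about Bałaban's actual
operators `Q̃`, `Δ^{(j)}(U_k)` is asserted: which `(Q, Δ)` the series feeds in is the business of the rows that build
`Beta.Family`s (OBJECTS.md §5).

DIVERGENCE / CONVENTION NOTE (cell row D-pv16.2).  "`∫ dB δ(Q̃B) …`" is not a Lebesgue integral of a function; the print fixes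
its meaning by (1.11) of [Balaban1984PropagatorsI] (product of coordinate δ's on the target lattice `T_L^{(1)}`, i.e. unit
mass per unit LEBESGUE volume of the target `ℝ^m`, pulled back by `Q`).  For `Q` onto this pull-back is a well-defined
positive measure on the fibre `{Qv = 0}` and three classical descriptions coincide: (i) the weak limit of `δ_ε(Qv) dv` for ANY
unit-mass approximate identity `δ_ε` on `ℝ^m` (this file: the Gaussian one, for which every `Z_ε` is itself a bordered
determinant, (2a)); (ii) the fibre integral `det(QQᵀ)^{−1/2} ∫_{ker Q} … dσ` (σ = Euclidean surface measure), i.e. with a kernel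
basis `C`: `det(QQᵀ)^{−1/2} det(CᵀC)^{1/2} ∫_{ℝ^r} … (Cw) dw` — pv23's Gram form; (iii) in adapted coordinates
`v = (v_σ, v_κ)` with `Q_κ` invertible: `|det Q_κ|^{−1} ∫ … dv_σ` — pv03-g3's form, Bałaban's B9 p. 428 elimination.  The tree
carries (i) here and the determinant identities making (ii), (iii) equal to it in the two sibling modules; pv25's `logZ` is
the common value.  A DIFFERENT normalisation of δ (e.g. unit mass w.r.t. the measure induced on `im Q` by declaring `Q` a
partial isometry, or w.r.t. counting measure on a lattice of spacing `L^{-j}`) would shift `log Z` by a constant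
`+½·log det(QQᵀ)` resp. a volume factor — constants in the background field when `Q̃` does not depend on it, NOT otherwise
(OBJECTS.md §5(a), GAPS G-beta-1): this is why the cell keeps the bordered form as the primary definition.

Unit `b2b-balaban-pv16` (surge node prover #16, gen 2), kernel node BETA-0-GAUSSINT-KERNEL (journal CLAIM
2026-08-18T17:55:40Z); cell rows C-pv16-2 (certification: integral half of C-beta-6), D-pv16.2 (the δ convention above).
-/

open MeasureTheory Matrix Real Filter Topology
open scoped Matrix MatrixOrder ComplexOrder

namespace Literature.MathematicalPhysics.QuantumFieldTheory.Balaban1983to89.Beta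

/-! ## Part 1 — the Gaussian integral of a positive definite form on `ι → ℝ` -/

namespace GaussianIntegral

variable {ι : Type*} [Fintype ι]

/-- `vᵀ(BᵀB)v = (Bv)ᵀ(Bv)` for a rectangular `B`. [folklore] -/
theorem dotProduct_transpose_mul_self_mulVec {κ : Type*} [Fintype κ] (B : Matrix κ ι ℝ) (v : ι → ℝ) :
    v ⬝ᵥ (Bᵀ * B) *ᵥ v = (B *ᵥ v) ⬝ᵥ (B *ᵥ v) := by
  rw [← Matrix.mulVec_mulVec, Matrix.dotProduct_mulVec, Matrix.vecMul_transpose]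

/-- The isotropic Gaussian integral on `ι → ℝ`: `∫ e^{−|w|²/2} dw = √(2π)^{|ι|}` (product measure; Mathlib's
`integral_gaussian` coordinatewise). [folklore] -/
theorem integral_exp_neg_half_dotProduct_self :
    ∫ w : ι → ℝ, Real.exp (-(1/2 : ℝ) * (w ⬝ᵥ w)) = Real.sqrt (2 * π) ^ Fintype.card ι := by
  have h : ∀ w : ι → ℝ, Real.exp (-(1/2 : ℝ) * (w ⬝ᵥ w)) = ∏ i, Real.exp (-(1/2 : ℝ) * (w i) ^ 2) := by
    intro w
    rw [← Real.exp_sum, dotProduct, Finset.mul_sum]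
    congr 1
    exact Finset.sum_congr rfl fun i _ => by ring
  simp_rw [h]
  rw [MeasureTheory.integral_fintype_prod_volume_eq_pow (fun x : ℝ => Real.exp (-(1/2 : ℝ) * x ^ 2)),
    integral_gaussian]
  congr 1
  congr 1
  ring

/-- Integrability of the isotropic Gaussian. [folklore] -/
theorem integrable_exp_neg_half_dotProduct_self :
    Integrable (fun w : ι → ℝ => Real.exp (-(1/2 : ℝ) * (w ⬝ᵥ w))) := by
  have h : ∀ w : ι → ℝ, Real.exp (-(1/2 : ℝ) * (w ⬝ᵥ w)) = ∏ i, Real.exp (-(1/2 : ℝ) * (w i) ^ 2) := by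
    intro w
    rw [← Real.exp_sum, dotProduct, Finset.mul_sum]
    congr 1
    exact Finset.sum_congr rfl fun i _ => by ring
  simp_rw [h]
  exact MeasureTheory.Integrable.fintype_prod (f := fun (_ : ι) (x : ℝ) => Real.exp (-(1/2 : ℝ) * x ^ 2))
    (fun _ => integrable_exp_neg_mul_sq (by norm_num))

variable [DecidableEq ι]

/-- LINEAR CHANGE OF VARIABLES on `ι → ℝ`: `∫ f(Bv) dv = |det B|⁻¹ · ∫ f` for `det B ≠ 0` (Lebesgue measure under a linear
automorphism, `map_linearMap_addHaar_eq_smul_addHaar`; no measurability needed, both sides junk together). [folklore] -/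
theorem integral_comp_mulVec (B : Matrix ι ι ℝ) (hB : B.det ≠ 0) (f : (ι → ℝ) → ℝ) :
    ∫ v, f (B *ᵥ v) = |B.det|⁻¹ * ∫ v, f v := by
  have hdet : LinearMap.det (Matrix.toLin' B) ≠ 0 := by rwa [LinearMap.det_toLin']
  set e₀ : (ι → ℝ) ≃ₗ[ℝ] (ι → ℝ) := LinearMap.equivOfDetNeZero (Matrix.toLin' B) hdet with he₀
  set e : (ι → ℝ) ≃ᵐ (ι → ℝ) := e₀.toContinuousLinearEquiv.toHomeomorph.toMeasurableEquiv with he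
  have hecoe : (e : (ι → ℝ) → (ι → ℝ)) = fun v => B *ᵥ v := by
    funext v
    simp [he, he₀]
  have hmap := MeasureTheory.Measure.map_linearMap_addHaar_eq_smul_addHaar
    (μ := (volume : Measure (ι → ℝ))) hdet
  have hcoe' : (Matrix.toLin' B : (ι → ℝ) → (ι → ℝ)) = (e : (ι → ℝ) → (ι → ℝ)) := by
    rw [hecoe]; funext v; simp
  calc ∫ v, f (B *ᵥ v) = ∫ v, f (e v) := by rw [hecoe]
    _ = ∫ y, f y ∂(Measure.map e volume) := (MeasureTheory.integral_map_equiv e f).symm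
    _ = ∫ y, f y ∂(ENNReal.ofReal |(LinearMap.det (Matrix.toLin' B))⁻¹| • (volume : Measure (ι → ℝ))) := by
        rw [← hmap, hcoe']
    _ = |B.det|⁻¹ * ∫ v, f v := by
        rw [integral_smul_measure, ENNReal.toReal_ofReal (abs_nonneg _), LinearMap.det_toLin', abs_inv,
          smul_eq_mul]

/-- Integrability transfers along `v ↦ Bv`, `det B ≠ 0`. [folklore] -/
theorem integrable_comp_mulVec (B : Matrix ι ι ℝ) (hB : B.det ≠ 0) {f : (ι → ℝ) → ℝ} (hf : Integrable f) :
    Integrable (fun v => f (B *ᵥ v)) := by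
  have hdet : LinearMap.det (Matrix.toLin' B) ≠ 0 := by rwa [LinearMap.det_toLin']
  set e₀ : (ι → ℝ) ≃ₗ[ℝ] (ι → ℝ) := LinearMap.equivOfDetNeZero (Matrix.toLin' B) hdet with he₀
  set e : (ι → ℝ) ≃ᵐ (ι → ℝ) := e₀.toContinuousLinearEquiv.toHomeomorph.toMeasurableEquiv with he
  have hecoe : (e : (ι → ℝ) → (ι → ℝ)) = fun v => B *ᵥ v := by
    funext v
    simp [he, he₀]
  have hmap := MeasureTheory.Measure.map_linearMap_addHaar_eq_smul_addHaar
    (μ := (volume : Measure (ι → ℝ))) hdet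
  have hcoe' : (Matrix.toLin' B : (ι → ℝ) → (ι → ℝ)) = (e : (ι → ℝ) → (ι → ℝ)) := by
    rw [hecoe]; funext v; simp
  have h1 : Integrable f (Measure.map e volume) := by
    rw [← hcoe', hmap]
    exact hf.smul_measure ENNReal.ofReal_ne_top
  have h2 := (MeasureTheory.integrable_map_equiv e f).1 h1
  rw [hecoe] at h2
  exact h2

/-- THE GAUSSIAN INTEGRAL OF A POSITIVE DEFINITE FORM: `∫_{ι → ℝ} exp(−½ vᵀAv) dv = √(2π)^{|ι|} / √(det A)`.  Proof: `A = BᵀB`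
(positive definite ⇒ nonnegative in the C⋆-order on real matrices ⇒ `star B * B`), change of variables `w = Bv`,
`det A = (det B)²`. [folklore] -/
theorem integral_exp_neg_half_quadForm (A : Matrix ι ι ℝ) (hA : A.PosDef) :
    ∫ v : ι → ℝ, Real.exp (-(1/2 : ℝ) * (v ⬝ᵥ A *ᵥ v)) =
      Real.sqrt (2 * π) ^ Fintype.card ι / Real.sqrt A.det := by
  obtain ⟨B, hB⟩ : ∃ B : Matrix ι ι ℝ, A = Bᵀ * B := by
    obtain ⟨B, hB⟩ := CStarAlgebra.nonneg_iff_eq_star_mul_self.mp hA.posSemidef.nonneg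
    exact ⟨B, by rwa [Matrix.star_eq_conjTranspose, Matrix.conjTranspose_eq_transpose_of_trivial] at hB⟩
  have hdetA : A.det = B.det ^ 2 := by rw [hB, det_mul, det_transpose, sq]
  have hdetB : B.det ≠ 0 := by
    intro h
    have h' := hA.det_pos
    rw [hdetA, h] at h'
    simp at h'
  have h1 : ∀ v : ι → ℝ, Real.exp (-(1/2 : ℝ) * (v ⬝ᵥ A *ᵥ v)) =
      (fun w : ι → ℝ => Real.exp (-(1/2 : ℝ) * (w ⬝ᵥ w))) (B *ᵥ v) := by
    intro v
    simp only [hB, dotProduct_transpose_mul_self_mulVec]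
  have hs : Real.sqrt A.det = |B.det| := by rw [hdetA, Real.sqrt_sq_eq_abs]
  calc ∫ v : ι → ℝ, Real.exp (-(1/2 : ℝ) * (v ⬝ᵥ A *ᵥ v))
      = ∫ v : ι → ℝ, (fun w : ι → ℝ => Real.exp (-(1/2 : ℝ) * (w ⬝ᵥ w))) (B *ᵥ v) := by simp_rw [h1]
    _ = |B.det|⁻¹ * ∫ w : ι → ℝ, Real.exp (-(1/2 : ℝ) * (w ⬝ᵥ w)) :=
        integral_comp_mulVec B hdetB (fun w : ι → ℝ => Real.exp (-(1/2 : ℝ) * (w ⬝ᵥ w)))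
    _ = Real.sqrt (2 * π) ^ Fintype.card ι / Real.sqrt A.det := by
        rw [integral_exp_neg_half_dotProduct_self, hs, div_eq_inv_mul]

/-- Integrability of the Gaussian of a positive definite form. [folklore] -/
theorem integrable_exp_neg_half_quadForm (A : Matrix ι ι ℝ) (hA : A.PosDef) :
    Integrable (fun v : ι → ℝ => Real.exp (-(1/2 : ℝ) * (v ⬝ᵥ A *ᵥ v))) := by
  obtain ⟨B, hB⟩ : ∃ B : Matrix ι ι ℝ, A = Bᵀ * B := by
    obtain ⟨B, hB⟩ := CStarAlgebra.nonneg_iff_eq_star_mul_self.mp hA.posSemidef.nonneg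
    exact ⟨B, by rwa [Matrix.star_eq_conjTranspose, Matrix.conjTranspose_eq_transpose_of_trivial] at hB⟩
  have hdetA : A.det = B.det ^ 2 := by rw [hB, det_mul, det_transpose, sq]
  have hdetB : B.det ≠ 0 := by
    intro h
    have h' := hA.det_pos
    rw [hdetA, h] at h'
    simp at h'
  have h1 : ∀ v : ι → ℝ, Real.exp (-(1/2 : ℝ) * (v ⬝ᵥ A *ᵥ v)) =
      (fun w : ι → ℝ => Real.exp (-(1/2 : ℝ) * (w ⬝ᵥ w))) (B *ᵥ v) := by
    intro v
    simp only [hB, dotProduct_transpose_mul_self_mulVec]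
  simp_rw [h1]
  exact integrable_comp_mulVec B hdetB integrable_exp_neg_half_dotProduct_self

/-- Log form: `log ∫ exp(−½ vᵀAv) dv = (|ι|/2)·log 2π − ½·log det A`. [folklore] -/
theorem log_integral_exp_neg_half_quadForm (A : Matrix ι ι ℝ) (hA : A.PosDef) :
    Real.log (∫ v : ι → ℝ, Real.exp (-(1/2 : ℝ) * (v ⬝ᵥ A *ᵥ v))) =
      (Fintype.card ι : ℝ) / 2 * Real.log (2 * π) - (1/2 : ℝ) * Real.log A.det := by
  rw [integral_exp_neg_half_quadForm A hA]
  have h2π : 0 < Real.sqrt (2 * π) := Real.sqrt_pos.2 (by positivity)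
  have hdet : 0 < A.det := hA.det_pos
  rw [Real.log_div (pow_ne_zero _ h2π.ne') (Real.sqrt_pos.2 hdet).ne', Real.log_pow, Real.log_sqrt (by positivity),
    Real.log_sqrt hdet.le]
  ring

omit [DecidableEq ι] in
/-- **Finsler's lemma** (compactness form).  A symmetric `Δ` that is positive on `ker Q ∖ {0}` becomes positive definite
after adding `t·QᵀQ`, for all `t` beyond an explicit threshold (`(|min_{sphere} vᵀΔv| + 1)/min_{sphere ∩ {vᵀΔv ≤ 0}} |Qv|²`).
The printed hypothesis is B5 p. 19: "the quadratic form ⟨∂A, ∂A⟩ is positive on the subspace of A satisfying QA = 0, …".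
[folklore] -/
theorem exists_posDef_add_smul {κ : Type*} [Fintype κ] (Δ : Matrix ι ι ℝ) (Q : Matrix κ ι ℝ) (hΔ : Δ.IsSymm)
    (hker : ∀ v : ι → ℝ, v ≠ 0 → Q *ᵥ v = 0 → 0 < v ⬝ᵥ Δ *ᵥ v) :
    ∃ t₀ : ℝ, 0 < t₀ ∧ ∀ t : ℝ, t₀ ≤ t → (Δ + t • (Qᵀ * Q)).PosDef := by
  -- the two quadratic forms
  set f : (ι → ℝ) → ℝ := fun v => v ⬝ᵥ Δ *ᵥ v with hf
  set g : (ι → ℝ) → ℝ := fun v => (Q *ᵥ v) ⬝ᵥ (Q *ᵥ v) with hg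
  have hfc : Continuous f := continuous_id.dotProduct (continuous_const.matrix_mulVec continuous_id)
  have hgc : Continuous g :=
    (continuous_const.matrix_mulVec continuous_id).dotProduct (continuous_const.matrix_mulVec continuous_id)
  have hg0 : ∀ v, 0 ≤ g v := fun v => by
    simp only [hg, dotProduct, ← sq]; exact Finset.sum_nonneg fun i _ => sq_nonneg _
  -- the compact set `T = sphere ∩ {f ≤ 0}`, on which `g > 0`
  set S : Set (ι → ℝ) := Metric.sphere (0 : ι → ℝ) 1 with hS
  have hScpt : IsCompact S := isCompact_sphere _ _
  set T : Set (ι → ℝ) := S ∩ {v | f v ≤ 0} with hT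
  have hTcpt : IsCompact T := hScpt.inter_right (isClosed_le hfc continuous_const)
  have hgT : ∀ v ∈ T, 0 < g v := by
    intro v hv
    have hv0 : v ≠ 0 := by
      intro h0
      have := hv.1
      rw [hS, mem_sphere_zero_iff_norm, h0, norm_zero] at this
      exact zero_ne_one this
    rcases (hg0 v).lt_or_eq with h | h
    · exact h
    · exfalso
      have hQ : Q *ᵥ v = 0 := dotProduct_self_eq_zero.1 h.symm
      have := hker v hv0 hQ
      have h2 : f v ≤ 0 := hv.2
      exact absurd this (not_lt.2 h2)
  obtain ⟨δ, hδ, hδT⟩ := hTcpt.exists_forall_le' hgc.continuousOn (a := 0) hgT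
  -- `f` is bounded below on the sphere
  obtain ⟨M, hM⟩ := hScpt.bddBelow_image hfc.continuousOn
  have hMf : ∀ v ∈ S, M ≤ f v := fun v hv => hM ⟨v, hv, rfl⟩
  refine ⟨(|M| + 1) / δ, by positivity, fun t ht => ?_⟩
  have htpos : 0 < t := lt_of_lt_of_le (by positivity) ht
  have htδ : |M| + 1 ≤ t * δ := by
    have := (div_le_iff₀ hδ).1 ht
    linarith
  -- positivity on the sphere
  have hsphere : ∀ u ∈ S, 0 < f u + t * g u := by
    intro u hu
    by_cases hfu : f u ≤ 0
    · have huT : u ∈ T := ⟨hu, hfu⟩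
      have h1 := hδT u huT
      have h2 := hMf u hu
      have h3 : -|M| ≤ M := neg_abs_le M
      nlinarith
    · push Not at hfu
      have := hg0 u
      nlinarith
  -- the combined form and its homogeneity
  have hform : ∀ v : ι → ℝ, v ⬝ᵥ (Δ + t • (Qᵀ * Q)) *ᵥ v = f v + t * g v := by
    intro v
    rw [Matrix.add_mulVec, dotProduct_add, Matrix.smul_mulVec, dotProduct_smul,
      dotProduct_transpose_mul_self_mulVec, smul_eq_mul]
  have hhom : ∀ (c : ℝ) (v : ι → ℝ), f (c • v) + t * g (c • v) = c ^ 2 * (f v + t * g v) := by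
    intro c v
    simp only [hf, hg, Matrix.mulVec_smul, smul_dotProduct, dotProduct_smul, smul_eq_mul]
    ring
  refine Matrix.PosDef.of_dotProduct_mulVec_pos ?_ ?_
  · rw [Matrix.isHermitian_iff_isSymm]
    have hQQ : (Qᵀ * Q).IsSymm := by
      rw [Matrix.IsSymm, Matrix.transpose_mul, Matrix.transpose_transpose]
    exact hΔ.add (hQQ.smul t)
  · intro x hx
    rw [star_trivial, hform]
    have hxn : 0 < ‖x‖ := norm_pos_iff.2 hx
    set u : ι → ℝ := ‖x‖⁻¹ • x with hu
    have huS : u ∈ S := by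
      rw [hS, mem_sphere_zero_iff_norm, hu, norm_smul, norm_inv, norm_norm, inv_mul_cancel₀ hxn.ne']
    have hxu : x = ‖x‖ • u := by rw [hu, smul_inv_smul₀ hxn.ne']
    rw [hxu, hhom]
    exact mul_pos (pow_pos hxn 2) (hsphere u huS)

end GaussianIntegral

/-! ## Part 2 — the constrained Gaussian `∫ δ(Qv) e^{−½ vᵀΔv} dv` of (1.4), δ by B5 (1.11), over pv25's carrier -/

namespace ConstrainedGaussian

open GaussianIntegral

variable {n m : ℕ}

/-- The regularised precision `Δ_ε := Δ + ε⁻¹·QᵀQ` (the exponent of `δ_ε(Qv)·e^{−½vᵀΔv}` is `−½ vᵀΔ_εv`). [folklore] -/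
noncomputable def precReg (Z : ConstrainedGaussian n m) (ε : ℝ) : Matrix (Fin n) (Fin n) ℝ :=
  Z.Δ + ε⁻¹ • (Z.Qᵀ * Z.Q)

/-- The regularised bordered matrix `K_ε := [[Δ, Qᵀ],[Q, −ε·1]]`; `K_0 = Z.kkt` (`kktReg_zero`). [folklore] -/
noncomputable def kktReg (Z : ConstrainedGaussian n m) (ε : ℝ) : Matrix (Fin n ⊕ Fin m) (Fin n ⊕ Fin m) ℝ :=
  Matrix.fromBlocks Z.Δ Z.Qᵀ Z.Q (-(ε • (1 : Matrix (Fin m) (Fin m) ℝ)))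

/-- THE REGULARISED CONSTRAINED GAUSSIAN INTEGRAL `Z_ε := ∫_{ℝⁿ} δ_ε(Qv) exp(−½ vᵀΔv) dv` with the heat kernel
`δ_ε(y) = (2πε)^{−m/2} e^{−|y|²/(2ε)}` of `ℝ^m` in place of B5's `δ(y) = ∏_c δ(y_c)` ((1.11) p. 19), `y = Qv`; written with the
constant pulled out.  Model of [Balaban1987RG1] (1.4) `Z^{(j)}(U_k) = ∫ dB δ(Q̃B) exp[−½⟨B, Δ^{(j)}(U_k)B⟩]` before `ε ↓ 0`.
[cite: Balaban1987RG1, (1.4) p.260] -/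
noncomputable def regZ (Z : ConstrainedGaussian n m) (ε : ℝ) : ℝ :=
  (2 * π * ε) ^ (-((m : ℝ) / 2)) *
    ∫ v : Fin n → ℝ, Real.exp (-(1/2 : ℝ) * (v ⬝ᵥ Z.Δ *ᵥ v) - 1 / (2 * ε) * ((Z.Q *ᵥ v) ⬝ᵥ (Z.Q *ᵥ v)))

/-- `K_0` is pv25's bordered matrix. [folklore] -/
theorem kktReg_zero (Z : ConstrainedGaussian n m) : kktReg Z 0 = Z.kkt := by
  simp [kktReg, ConstrainedGaussian.kkt]

/-- UNIT MASS of the regularising kernel: `(2πε)^{−m/2} ∫_{ℝ^m} e^{−|y|²/(2ε)} dy = 1` — `δ_ε` is a probability density w.r.t.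
Lebesgue measure `dy = ∏_c dy_c` on the target, the product of the `m` one-dimensional heat kernels; this is the
normalisation fixed by B5 (1.11) `δ(B − QA) = ∏_c δ(B_c − (QA)_c)`. [cite: Balaban1984PropagatorsI, (1.11) p.19] -/
theorem heatKernel_mass_one {ε : ℝ} (hε : 0 < ε) :
    (2 * π * ε) ^ (-((m : ℝ) / 2)) * ∫ y : Fin m → ℝ, Real.exp (-(1 / (2 * ε)) * (y ⬝ᵥ y)) = 1 := by
  have h : ∀ y : Fin m → ℝ, Real.exp (-(1 / (2 * ε)) * (y ⬝ᵥ y)) = ∏ i, Real.exp (-(1 / (2 * ε)) * (y i) ^ 2) := by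
    intro y
    rw [← Real.exp_sum, dotProduct, Finset.mul_sum]
    congr 1
    exact Finset.sum_congr rfl fun i _ => by ring
  simp_rw [h]
  rw [MeasureTheory.integral_fintype_prod_volume_eq_pow (fun x : ℝ => Real.exp (-(1 / (2 * ε)) * x ^ 2)),
    integral_gaussian, Fintype.card_fin]
  have h2 : π / (1 / (2 * ε)) = 2 * π * ε := by field_simp
  rw [h2, Real.sqrt_eq_rpow, ← Real.rpow_natCast, ← Real.rpow_mul (by positivity), ← Real.rpow_add (by positivity)]
  have h3 : -((m : ℝ) / 2) + 1 / (2 : ℝ) * (m : ℝ) = 0 := by ring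
  rw [h3, Real.rpow_zero]

/-- The regularised integrand factors as Gaussian weight × kernel (up to the constant): 
`exp(−½vᵀΔv − |Qv|²/(2ε)) = exp(−½ vᵀΔv)·exp(−|Qv|²/(2ε))`. [folklore] -/
theorem regIntegrand_factor (Z : ConstrainedGaussian n m) (ε : ℝ) (v : Fin n → ℝ) :
    Real.exp (-(1/2 : ℝ) * (v ⬝ᵥ Z.Δ *ᵥ v) - 1 / (2 * ε) * ((Z.Q *ᵥ v) ⬝ᵥ (Z.Q *ᵥ v))) =
      Real.exp (-(1/2 : ℝ) * (v ⬝ᵥ Z.Δ *ᵥ v)) * Real.exp (-(1 / (2 * ε)) * ((Z.Q *ᵥ v) ⬝ᵥ (Z.Q *ᵥ v))) := by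
  rw [← Real.exp_add]
  congr 1
  ring

/-- The regularised integrand is the Gaussian of `Δ_ε`. [folklore] -/
theorem regIntegrand_eq (Z : ConstrainedGaussian n m) {ε : ℝ} (hε : ε ≠ 0) (v : Fin n → ℝ) :
    Real.exp (-(1/2 : ℝ) * (v ⬝ᵥ Z.Δ *ᵥ v) - 1 / (2 * ε) * ((Z.Q *ᵥ v) ⬝ᵥ (Z.Q *ᵥ v))) =
      Real.exp (-(1/2 : ℝ) * (v ⬝ᵥ (precReg Z ε) *ᵥ v)) := by
  congr 1
  rw [precReg, Matrix.add_mulVec, dotProduct_add, Matrix.smul_mulVec, dotProduct_smul,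
    dotProduct_transpose_mul_self_mulVec, smul_eq_mul]
  field_simp
  ring

/-- `Z_ε = (2πε)^{−m/2} ∫ exp(−½ vᵀΔ_εv) dv`. [folklore] -/
theorem regZ_eq (Z : ConstrainedGaussian n m) {ε : ℝ} (hε : ε ≠ 0) :
    regZ Z ε = (2 * π * ε) ^ (-((m : ℝ) / 2)) * ∫ v : Fin n → ℝ, Real.exp (-(1/2 : ℝ) * (v ⬝ᵥ (precReg Z ε) *ᵥ v)) := by
  rw [regZ]
  congr 1
  simp_rw [regIntegrand_eq Z hε]

/-- SCHUR COMPLEMENT on the invertible corner: `det K_ε = (−ε)^m · det Δ_ε`. [folklore] -/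
theorem det_kktReg (Z : ConstrainedGaussian n m) {ε : ℝ} (hε : ε ≠ 0) :
    (kktReg Z ε).det = (-ε) ^ m * (precReg Z ε).det := by
  letI : Invertible (-(ε • (1 : Matrix (Fin m) (Fin m) ℝ))) :=
    ⟨-(ε⁻¹ • (1 : Matrix (Fin m) (Fin m) ℝ)), by simp [smul_smul, hε], by simp [smul_smul, hε]⟩
  have hinv : ⅟(-(ε • (1 : Matrix (Fin m) (Fin m) ℝ))) = -(ε⁻¹ • (1 : Matrix (Fin m) (Fin m) ℝ)) := rfl
  rw [kktReg, Matrix.det_fromBlocks₂₂, hinv]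
  have h1 : Z.Δ - Z.Qᵀ * -(ε⁻¹ • (1 : Matrix (Fin m) (Fin m) ℝ)) * Z.Q = precReg Z ε := by
    rw [precReg, Matrix.mul_neg, Matrix.neg_mul, sub_neg_eq_add, Matrix.mul_smul, Matrix.mul_one,
      Matrix.smul_mul]
  rw [h1, det_neg, det_smul, det_one, mul_one, Fintype.card_fin, ← mul_pow, neg_one_mul]

/-- `Z_ε > 0` when `Δ_ε` is positive definite. [folklore] -/
theorem regZ_pos (Z : ConstrainedGaussian n m) {ε : ℝ} (hε : 0 < ε) (hP : (precReg Z ε).PosDef) : 0 < regZ Z ε := by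
  rw [regZ_eq Z hε.ne', integral_exp_neg_half_quadForm _ hP]
  exact mul_pos (Real.rpow_pos_of_pos (by positivity) _)
    (div_pos (pow_pos (Real.sqrt_pos.2 (by positivity)) _) (Real.sqrt_pos.2 hP.det_pos))

/-- CLOSED FORM AT FIXED `ε > 0`: if `Δ_ε` is positive definite then `log Z_ε = ((n − m)/2)·log 2π − ½·log |det K_ε|` —
pv25's formula for `logZ` with the bordered matrix regularised in its zero corner. [cite: Balaban1987RG1, (1.4) p.260] -/
theorem log_regZ_eq (Z : ConstrainedGaussian n m) {ε : ℝ} (hε : 0 < ε) (hP : (precReg Z ε).PosDef) :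
    Real.log (regZ Z ε) = ((n : ℝ) - m) / 2 * Real.log (2 * π) - (1/2 : ℝ) * Real.log |(kktReg Z ε).det| := by
  have hdetP : 0 < (precReg Z ε).det := hP.det_pos
  have hIpos : 0 < ∫ v : Fin n → ℝ, Real.exp (-(1/2 : ℝ) * (v ⬝ᵥ (precReg Z ε) *ᵥ v)) := by
    rw [integral_exp_neg_half_quadForm _ hP]
    exact div_pos (pow_pos (Real.sqrt_pos.2 (by positivity)) _) (Real.sqrt_pos.2 hdetP)
  have hc : 0 < (2 * π * ε) ^ (-((m : ℝ) / 2)) := Real.rpow_pos_of_pos (by positivity) _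
  rw [regZ_eq Z hε.ne', Real.log_mul hc.ne' hIpos.ne', log_integral_exp_neg_half_quadForm _ hP,
    Real.log_rpow (by positivity), det_kktReg Z hε.ne', abs_mul, abs_pow, abs_neg, abs_of_pos hε,
    abs_of_pos hdetP, Real.log_mul (pow_ne_zero _ hε.ne') hdetP.ne', Real.log_pow,
    Real.log_mul (by positivity) hε.ne', Fintype.card_fin]
  ring

/-- Under `Regular`, `Δ_ε` is positive definite for all small `ε > 0` (Finsler's lemma with `t = ε⁻¹`). [folklore] -/
theorem eventually_posDef_precReg (Z : ConstrainedGaussian n m) (hZ : Z.Regular) :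
    ∃ ε₀ : ℝ, 0 < ε₀ ∧ ∀ ε : ℝ, 0 < ε → ε < ε₀ → (precReg Z ε).PosDef := by
  obtain ⟨t₀, ht₀, h⟩ := exists_posDef_add_smul Z.Δ Z.Q hZ.symm hZ.posKer
  refine ⟨t₀⁻¹, inv_pos.2 ht₀, fun ε hε hεlt => ?_⟩
  have : t₀ ≤ ε⁻¹ := by
    rw [← inv_inv t₀]
    exact inv_anti₀ hε hεlt.le
  exact h _ this

/-- `ε ↦ det K_ε` is continuous (polynomial in `ε`). [folklore] -/
theorem continuous_det_kktReg (Z : ConstrainedGaussian n m) : Continuous fun ε : ℝ => (kktReg Z ε).det := by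
  refine Continuous.matrix_det ?_
  unfold kktReg
  exact Continuous.matrix_fromBlocks continuous_const continuous_const continuous_const
    (continuous_id.smul continuous_const).neg

/-- PRIVATE instance of "`Regular` ⇒ `det Z.kkt ≠ 0`" (`ker [[Δ,Qᵀ],[Q,0]] = 0` from `Q` onto and `Δ > 0` on `ker Q`), needed
by the limit theorems.  The PUBLIC statement is unit pv23's (`…Beta.KKTBridge`, BETA-0 split NOTE 2026-08-18T18:01:47Z);
this private copy is to be replaced by an import of that theorem once it lands. [folklore] -/
private theorem det_kkt_ne_zero_of_regular (Z : ConstrainedGaussian n m) (hZ : Z.Regular) : Z.kkt.det ≠ 0 := by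
  intro hdet
  obtain ⟨x, hx0, hx⟩ := Matrix.exists_mulVec_eq_zero_iff.2 hdet
  set v : Fin n → ℝ := x ∘ Sum.inl with hv
  set l : Fin m → ℝ := x ∘ Sum.inr with hl
  have hxe : x = Sum.elim v l := (Sum.elim_comp_inl_inr x).symm
  rw [hxe, ConstrainedGaussian.kkt, Matrix.fromBlocks_mulVec] at hx
  have h1 : Z.Δ *ᵥ v + Z.Qᵀ *ᵥ l = 0 := by
    funext i; simpa using congrFun hx (Sum.inl i)
  have h2 : Z.Q *ᵥ v = 0 := by
    funext j; simpa using congrFun hx (Sum.inr j)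
  have h3 : v ⬝ᵥ Z.Δ *ᵥ v = 0 := by
    have h := congrArg (fun w => v ⬝ᵥ w) h1
    simp only [dotProduct_add, dotProduct_zero] at h
    have h4 : v ⬝ᵥ Z.Qᵀ *ᵥ l = 0 := by
      rw [Matrix.dotProduct_mulVec, Matrix.vecMul_transpose, h2, zero_dotProduct]
    linarith
  have hv0 : v = 0 := by
    by_contra hne
    exact (hZ.posKer v hne h2).ne' h3
  have hl0 : l = 0 := by
    rw [hv0, Matrix.mulVec_zero, zero_add] at h1
    obtain ⟨w, hw⟩ := hZ.onto l
    have h5 : l ⬝ᵥ l = 0 := by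
      calc l ⬝ᵥ l = (Z.Q *ᵥ w) ⬝ᵥ l := by rw [hw]
        _ = w ⬝ᵥ Z.Qᵀ *ᵥ l := by rw [Matrix.dotProduct_mulVec w, Matrix.vecMul_transpose]
        _ = 0 := by rw [h1, dotProduct_zero]
    exact dotProduct_self_eq_zero.1 h5
  apply hx0
  rw [hxe, hv0, hl0]
  funext i; cases i <;> rfl

/-- THE LIMIT THEOREM (log form).  Under `Regular`, `log Z_ε → Z.logZ` as `ε ↓ 0`: pv25's closed form
`((n − m)/2)·log 2π − ½·log |det [[Δ,Qᵀ],[Q,0]]|` IS the logarithm of the constrained Gaussian integral (1.4) with the δ of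
B5 (1.11) (as the limit of its heat-kernel regularisations). [cite: Balaban1987RG1, (1.4) p.260] -/
theorem tendsto_log_regZ (Z : ConstrainedGaussian n m) (hZ : Z.Regular) :
    Tendsto (fun ε => Real.log (regZ Z ε)) (𝓝[>] 0) (𝓝 Z.logZ) := by
  obtain ⟨ε₀, hε₀, hP⟩ := eventually_posDef_precReg Z hZ
  have hEq : (fun ε => ((n : ℝ) - m) / 2 * Real.log (2 * π) - (1/2 : ℝ) * Real.log ((kktReg Z ε).det))
      =ᶠ[𝓝[>] 0] fun ε => Real.log (regZ Z ε) := by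
    filter_upwards [Ioo_mem_nhdsGT hε₀] with ε hε
    rw [log_regZ_eq Z hε.1 (hP ε hε.1 hε.2), Real.log_abs]
  refine Filter.Tendsto.congr' hEq ?_
  have hdet : Tendsto (fun ε : ℝ => (kktReg Z ε).det) (𝓝[>] 0) (𝓝 Z.kkt.det) := by
    have h := (continuous_det_kktReg Z).tendsto 0
    rw [kktReg_zero] at h
    exact tendsto_nhdsWithin_of_tendsto_nhds h
  have hlim := ((hdet.log (det_kkt_ne_zero_of_regular Z hZ)).const_mul (1/2 : ℝ)).const_sub
    (((n : ℝ) - m) / 2 * Real.log (2 * π))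
  have hZdef : Z.logZ = ((n : ℝ) - m) / 2 * Real.log (2 * π) - (1/2 : ℝ) * Real.log Z.kkt.det := by
    rw [ConstrainedGaussian.logZ, Real.log_abs]
  rw [hZdef]
  exact hlim

/-- THE LIMIT THEOREM.  Under `Regular`, `Z_ε → exp(Z.logZ)` as `ε ↓ 0`: the constrained Gaussian integral (1.4) exists as
the limit of its regularisations and its value is `exp` of pv25's `logZ`. [cite: Balaban1987RG1, (1.4) p.260] -/
theorem tendsto_regZ (Z : ConstrainedGaussian n m) (hZ : Z.Regular) :
    Tendsto (regZ Z) (𝓝[>] 0) (𝓝 (Real.exp Z.logZ)) := by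
  obtain ⟨ε₀, hε₀, hP⟩ := eventually_posDef_precReg Z hZ
  have hEq : (fun ε => Real.exp (Real.log (regZ Z ε))) =ᶠ[𝓝[>] 0] regZ Z := by
    filter_upwards [Ioo_mem_nhdsGT hε₀] with ε hε
    exact Real.exp_log (regZ_pos Z hε.1 (hP ε hε.1 hε.2))
  exact Filter.Tendsto.congr' hEq ((Real.continuous_exp.tendsto _).comp (tendsto_log_regZ Z hZ))

/-- The value in product form: under `Regular`, `exp(Z.logZ) = (2π)^{(n−m)/2} · |det Z.kkt|^{−1/2}`. [folklore] -/
theorem exp_logZ (Z : ConstrainedGaussian n m) (hZ : Z.Regular) :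
    Real.exp Z.logZ = (2 * π) ^ (((n : ℝ) - m) / 2) * |Z.kkt.det| ^ (-(1/2 : ℝ)) := by
  have h2π : 0 < 2 * π := by positivity
  have hK : 0 < |Z.kkt.det| := abs_pos.2 (det_kkt_ne_zero_of_regular Z hZ)
  rw [ConstrainedGaussian.logZ, Real.exp_sub, Real.rpow_def_of_pos h2π, Real.rpow_def_of_pos hK, div_eq_mul_inv,
    ← Real.exp_neg]
  congr 1
  · congr 1; ring
  · congr 1; ring

/-! ### B9's reduced normalisation `Z′^{(k)}` ((3.157) p. 428) and the dictionary `Z ↔ Z′` -/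

/-- `wᵀ(CᵀΔC)w = (Cw)ᵀΔ(Cw)`. [folklore] -/
theorem dotProduct_reduced_mulVec (Z : ConstrainedGaussian n m) {r : ℕ} (C : Matrix (Fin n) (Fin r) ℝ)
    (w : Fin r → ℝ) : w ⬝ᵥ (Z.reduced C) *ᵥ w = (C *ᵥ w) ⬝ᵥ Z.Δ *ᵥ (C *ᵥ w) := by
  rw [ConstrainedGaussian.reduced, ← Matrix.mulVec_mulVec, ← Matrix.mulVec_mulVec, Matrix.dotProduct_mulVec,
    Matrix.vecMul_transpose]

/-- Under `Regular`, the reduced form along ANY injective kernel parametrisation `C` (`QC = 0`) is positive definite —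
B9 p. 428: "a positive definite operator C\*Δ_kC". [cite: Balaban1985BackgroundPropagators, (3.157) p.428] -/
theorem posDef_reduced (Z : ConstrainedGaussian n m) (hZ : Z.Regular) {r : ℕ} (C : Matrix (Fin n) (Fin r) ℝ)
    (hQC : Z.Q * C = 0) (hC : Function.Injective C.mulVec) : (Z.reduced C).PosDef := by
  refine Matrix.PosDef.of_dotProduct_mulVec_pos ?_ ?_
  · rw [Matrix.isHermitian_iff_isSymm]
    exact Z.reduced_isSymm C hZ.symm
  · intro w hw
    rw [star_trivial, dotProduct_reduced_mulVec]
    have hCw : C *ᵥ w ≠ 0 := by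
      intro h
      apply hw
      apply hC
      rw [h, Matrix.mulVec_zero]
    have hQ : Z.Q *ᵥ (C *ᵥ w) = 0 := by rw [Matrix.mulVec_mulVec, hQC, Matrix.zero_mulVec]
    exact hZ.posKer _ hCw hQ

/-- CERTIFICATION of pv25's `logZred`: it is the logarithm of B9's Gaussian integral `∫_{ℝ^r} exp(−½⟨w, CᵀΔC w⟩) dw`
(whenever `CᵀΔC` is positive definite). [cite: Balaban1985BackgroundPropagators, (3.157) p.428] -/
theorem log_integral_reduced (Z : ConstrainedGaussian n m) {r : ℕ} (C : Matrix (Fin n) (Fin r) ℝ)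
    (hC : (Z.reduced C).PosDef) :
    Real.log (∫ w : Fin r → ℝ, Real.exp (-(1/2 : ℝ) * (w ⬝ᵥ (Z.reduced C) *ᵥ w))) = Z.logZred C := by
  rw [log_integral_exp_neg_half_quadForm _ hC, ConstrainedGaussian.logZred, Fintype.card_fin]

/-- THE DICTIONARY `Z ↔ Z′` in closed form (definitional): for `r + m = n` (a kernel basis has `n − m` columns),
`Z.logZ − Z.logZred C = ½·(log det(CᵀΔC) − log |det Z.kkt|)` — the Jacobian of `w ↦ Cw` relative to `δ(Q·)`; its evaluation
(`= ½·log det(CᵀC) − ½·log det(QQᵀ)`, `= −log |det Q_κ|` in adapted coordinates) is the determinant algebra of the sibling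
modules `…Beta.ConstraintElimination` / `…Beta.KKTBridge`, not repeated here. [folklore] -/
theorem logZ_sub_logZred (Z : ConstrainedGaussian n m) {r : ℕ} (C : Matrix (Fin n) (Fin r) ℝ) (hr : r + m = n) :
    Z.logZ - Z.logZred C = (1/2 : ℝ) * (Real.log (Z.reduced C).det - Real.log |Z.kkt.det|) := by
  have hr' : ((n : ℝ) - m) = r := by
    have : (n : ℝ) = r + m := by exact_mod_cast hr.symm
    linarith
  rw [ConstrainedGaussian.logZ, ConstrainedGaussian.logZred, hr']
  ring

end ConstrainedGaussian

end Literature.MathematicalPhysics.QuantumFieldTheory.Balaban1983to89.Beta
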